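import Summits.Ventures.CertifiedManyBodySolver.Rows.HubbardChainMPSNodes
import Summits.Ventures.CertifiedManyBodySolver.Transport.MPSPrimalHubbardChainSrot
import Summits.Ventures.CertifiedManyBodySolver.Transport.ChainWindowSpinRotationRows

/-!
# Row predicates for the SPIN-ROTATED (`jw-srot`) lane-B / L3-D6 by-value nodes of the Hubbard chain (`t = 1`):
# the `jw-srot` `lti(N)` window node, the `jw-srot` `relax = mps(N, D, A)` node, and their solver-free EDGES to `LTIChainKSDNNode`

HONEST FRAMING: first certified bounds; not a superconductivity verdict; every number certified or labelled float.

WHAT THIS FILE IS (programme hubbard-alg, LIT team lit-1 gen-13; LEAD ruling r156 (g1) object **LD1′**, pub-hubbard liaison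
HOME/INBOX l.4904 (3)). FORMAT-ltisdp's model form `jw-srot` (§4.11, `hubbard_jwsrot_U<U>`; SOUNDNESS-ltisdp S8 (b)) is the Hubbard
chain with spin-flipped hopping `H' = −t Σ_{i,σ} (c†_{iσ} c_{i+1,σ̄} + h.c.) + U Σ_i n_{i↑}n_{i↓}` — the image of the standard form under
the product of one-site spin flips on the odd sites — with the single one-site charge `n_tot` (`q_eff(s) = cb·n_tot(s) − ca`,
`cov_mult = (cb,)`, `cov_off = (ca,)`, filling `ν = ca/cb`). The L3 lever's D6 rung (MPS-compressed LTI / KSDN chain lowers,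
`L3-hybrid/DESIGN-D6-lti.md`) runs on `N`-only-charged `jw-srot` tensors. The tree proves the two transports

* `Transport.ksdnClaim_of_srotClaim` (`Transport/ChainWindowSpinRotationRows.lean`): the `jw-srot` window statement on `{-1, …, n+1}`
  (TOTAL-OCCUPATION sectors, bond `U n_{-1↑}n_{-1↓} − Σ_σ (c†_{-1σ} c_{0σ̄} + h.c.)`) IMPLIES the standard window statement = the binder
  list of `LTIChainKSDNNode U n ν lo` (`Rows/ChainMarginalNodes.lean`) — spin-flip midpoint, then conjugation by `⨂_x v_x`;
* `Transport.ksdnSrotClaim_of_mpsSrotClaim` (`Transport/MPSPrimalHubbardChainSrot.lean`): the `jw-srot` `relax = mps(N, D, A)` statement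
  IMPLIES the `jw-srot` window statement (KSDN's feasible point, charge group `ℤ`).

This file NAMES the two hypothesis shapes as ROW PREDICATES with rational slots — `LTIChainKSDNNodeSrot U n ν lo` and
`MPSChainKSDNNodeSrot U n D A qb cb ca B ν lo` (window `{-1, …, n+1}` of `N = n + 3` sites = the problem file's `n`; bond dimension `D`;
`A : Fin 4 → Matrix (Fin D) (Fin D) ℚ` = `meta.A` VERBATIM in the site basis `s = n↑ + 2n↓` = the tree's `siteOcc`; `qb : Fin D → ℤ` =
`meta.bond_charges`; `(cb, ca)` = `(cov_mult, cov_off)`; `B m` = `max(1, meta.omega_entry_bounds[m])`; `ν` = the density row's value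
(total density of the first site); `lo` = `claimed.bound`) — and proves the solver-free EDGES BY NAME
`LTIChainKSDNNodeSrot.ltiChainKSDNNode`, `MPSChainKSDNNodeSrot.ltiChainKSDNNodeSrot` (under the two RATIONAL side conditions: charge
covariance of `A` for `hubbardSrotQeff cb ca`, FORMAT §4.12 "CHECKED at generation"; `frobSqQ (transferOpQ A ^ (m−2)) ≤ (B m)²`,
`0 ≤ B m`, FORMAT §4.7), `MPSChainKSDNNodeSrot.ltiChainKSDNNode`, whence the M1 cells BY NAME through `LTIChainKSDNNode`'s cells:
`….m1EnergyLowerRow` (`ν = 1`), `….m1DopedEnergyLowerRow` (`ν = p/q`); and `….mono`. A certified D6 `jw-srot` row is thus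
Lean-consumable as ONE claim node `h : MPSChainKSDNNodeSrot …` ⊢ `M1[Doped]EnergyLowerRow` (BOARD D-8 shape).

NOTHING IS ASSERTED HERE: the nodes are `def … : Prop` taken as hypotheses; nodes are instantiated only under `Certificates/` from
certificate files. No `sorry`, no new axiom, no named fact. [cite: KullEtAl2024, §2.3–2.5, §4.2, §6.2] [cite: ArakiMoriya2003, §4.1]
[cite: EsslerEtAl2005, §12.3.4 eqs. (12.196)–(12.201)]
-/

noncomputable section

open Matrix Complex Filter Topology
open scoped ComplexOrder Kronecker BigOperators
open Literature.Probability.LatticeModels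
open Literature.MathematicalPhysics.QuantumLattice
open Literature.MathematicalPhysics.QuantumLattice.HubbardWave0
open Literature.MathematicalPhysics.QuantumLattice.ThermodynamicLimit
open Literature.MathematicalPhysics.QuantumLattice.JordanWigner
open Literature.MathematicalPhysics.QuantumManyBody.StateRelaxation
open Literature.MathematicalPhysics.QuantumLattice.MPSCoarseGraining
open Literature.Computability.QuantumComplexity (traceLeft traceRight)
open Summit.Ventures.CertifiedManyBodySolver.Transport

namespace Summit.Ventures.CertifiedManyBodySolver

/-! ## §A  Data: the `jw-srot` charge `q_eff = cb·n_tot − ca` -/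

section Data

/-- FORMAT-ltisdp's effective charge of the `jw-srot` model form, `q_eff(s) = cb·n_tot(s) − ca` (`charges = [(n_tot)]`,
`cov_mult = (cb,)`, `cov_off = (ca,)`; filling `ν = ca/cb`), in the tree's site basis `siteOcc` (`n_tot(s) = |occ(s)|`).
[cite: KullEtAl2024, §3.3] -/
def hubbardSrotQeff (cb ca : ℤ) (s : Fin 4) : ℤ := cb * ((siteOcc s).card : ℤ) - ca

/-- Unfolding `hubbardSrotQeff`. -/
@[simp] theorem hubbardSrotQeff_apply (cb ca : ℤ) (s : Fin 4) : hubbardSrotQeff cb ca s = cb * ((siteOcc s).card : ℤ) - ca := rfl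

end Data

/-! ## §B  The node predicates (window `{-1, …, n+1}` of `N = n + 3` sites, model `hubbard_jwsrot(U)`, `t = 1`) -/

section Nodes

/-- **`jw-srot` `lti(n)` node, FORMAT-ltisdp form** (the hypothesis of `Transport.ksdnClaim_of_srotClaim` at `t = 1`; model
`hubbard_jwsrot(U)`, FORMAT-ltisdp §4.11): for every window variable `ρ : Op (PolySite {-1, …, n+1}) 4` with `ρ ⪰ 0`, `tr ρ = 1`, the
local-translation-invariance row `tr_{-1} ρ = tr_{n+1} ρ` (as an equality of pulled-back marginals), the TOTAL-OCCUPATION sector zeros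
(`N = N↑ + N↓` is the only one-site charge of the `jw-srot` form), the total density of the first site `-1` equal to `ν`, real entries
bounded by one: `lo ≤ Re tr(toSpin(U n_{-1↑}n_{-1↓} − Σ_σ (c†_{-1σ} c_{0σ̄} + c†_{0σ̄} c_{-1σ})) ρ)` (the `jw-srot` first bond, `U` on
the LEFT site, `t = 1`). [cite: KullEtAl2024, §II.B eq. (locTIn), §VI.B] -/
def LTIChainKSDNNodeSrot (U : ℝ) (n : ℕ) (ν lo : ℚ) : Prop :=
  ∀ ρ : Op (PolySite (chainWindow (-1) ((n : ℤ) + 1))) 4, ρ.PosSemidef → ρ.trace = 1 →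
    spinPartialTrace ((PolySite.affEmb 1 (unitVec 0) (chainWindow (-1) (n : ℤ))).trans
        (PolySite.incl (affShiftSet_chainWindow_subset (-1) (n : ℤ)))) ρ =
      spinPartialTrace (PolySite.incl (chainWindow_mono_right (-1) (by omega : (n : ℤ) ≤ n + 1))) ρ →
    (∀ k k' : TensorIndex (PolySite (chainWindow (-1) ((n : ℤ) + 1))) 4,
      (∑ x, (siteOcc (k x)).card) ≠ (∑ x, (siteOcc (k' x)).card) → ρ k k' = 0) →
    ((toSpin (nAt (-unitVec 0) (neg_unitVec_mem_chainWindow (by omega : (-1 : ℤ) ≤ n + 1)) 0 +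
        nAt (-unitVec 0) (neg_unitVec_mem_chainWindow (by omega : (-1 : ℤ) ≤ n + 1)) 1) * ρ).trace).re = ((ν : ℚ) : ℝ) →
    (∀ k k' : TensorIndex (PolySite (chainWindow (-1) ((n : ℤ) + 1))) 4, starRingEnd ℂ (ρ k k') = ρ k k') →
    (∀ k k' : TensorIndex (PolySite (chainWindow (-1) ((n : ℤ) + 1))) 4, ‖ρ k k'‖ ≤ 1) →
    ((lo : ℚ) : ℝ) ≤ ((toSpin ((U : ℂ) • (nAt (-unitVec 0) (neg_unitVec_mem_chainWindow (by omega : (-1 : ℤ) ≤ n + 1)) 0 *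
          nAt (-unitVec 0) (neg_unitVec_mem_chainWindow (by omega : (-1 : ℤ) ≤ n + 1)) 1) +
        (-((1 : ℝ) : ℂ)) • ∑ σ : Fin 2,
          ((cAt (-unitVec 0) (neg_unitVec_mem_chainWindow (by omega : (-1 : ℤ) ≤ n + 1)) σ)ᴴ *
              cAt 0 (zero_mem_chainWindow (by omega : (0 : ℤ) ≤ n + 1)) σ.rev +
            (cAt 0 (zero_mem_chainWindow (by omega : (0 : ℤ) ≤ n + 1)) σ.rev)ᴴ *
              cAt (-unitVec 0) (neg_unitVec_mem_chainWindow (by omega : (-1 : ℤ) ≤ n + 1)) σ)) * ρ).trace).re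

/-- **`jw-srot` `relax = mps(N, D, A)` node, FORMAT-ltisdp form** (the `hclaim` of `Transport.ksdnSrotClaim_of_mpsSrotClaim` at `t = 1`
with rational data; model `hubbard_jwsrot(U)`, FORMAT §1, §4.7, §4.11): for all variables `ρ₃ : Op (PolySite {-1,0,1}) 4` and `ω m`
(`4 ≤ m ≤ n + 3`, indexed `(s_L, (a,b), s_R)`), IF `ρ₃ ⪰ 0`, `tr ρ₃ = 1`, the LTI row `tr_{-1} ρ₃ = tr_{1} ρ₃`, the TOTAL-OCCUPATION sector
zeros, the total density of site `-1` equal to `ν`, real entries, `|ρ₃| ≤ 1` (VERBATIM the binders of `LTIChainKSDNNodeSrot U 0 ν ·`);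
row E4L `tr_{s_L} ω₄ = (W₂ ⊗ 𝟙) ρ̃₃ (W₂ ⊗ 𝟙)ᴴ` and row E4R `tr_{s_R} ω₄ = (𝟙 ⊗ W₂) ρ̃₃ (𝟙 ⊗ W₂)ᴴ` with `ρ̃₃ = ρ₃` read through
`chainWindowThreeEquiv` (then as (first two sites, last site) / (first site, last two)) and `W₂ = cgMap (castTensor A) 2`; rows
E_mL / E_mR for `5 ≤ m ≤ n+3` (`L = leftMap`, `R = rightMap` of `castTensor A`); `ω_m ⪰ 0`, sector zeros for
`cgTag (hubbardSrotQeff cb ca) qb`, real entries, `|ω_m| ≤ B m` (`4 ≤ m ≤ n+3`) — THEN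
`lo ≤ Re tr(toSpin(U n_{-1↑}n_{-1↓} − Σ_σ (c†_{-1σ} c_{0σ̄} + c†_{0σ̄} c_{-1σ})) ρ₃)` (`jw-srot` bond, `U` on the LEFT site, `t = 1`).
By-name audit token: predicate NAME + `(U, n + 3 = the file's n, D, ν, lo)` + the tables `A` (= `meta.A`), `qb` (= `meta.bond_charges`),
`(cb, ca)` (= `cov_mult, cov_off`), `B m` (= `max(1, meta.omega_entry_bounds[m])`).
[cite: KullEtAl2024, §2.5 eq. (TNfullRelax5), §4.2 eq. (relaxLocTIn), §6.2] -/
def MPSChainKSDNNodeSrot (U : ℝ) (n D : ℕ) (A : Fin 4 → Matrix (Fin D) (Fin D) ℚ) (qb : Fin D → ℤ) (cb ca : ℤ) (B : ℕ → ℚ)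
    (ν lo : ℚ) : Prop :=
  ∀ (ρ₃ : Op (PolySite (chainWindow (-1) 1)) 4)
    (ω : ℕ → Matrix (Fin 4 × ((Fin D × Fin D) × Fin 4)) (Fin 4 × ((Fin D × Fin D) × Fin 4)) ℂ),
    ρ₃.PosSemidef → ρ₃.trace = 1 →
    spinPartialTrace ((PolySite.affEmb 1 (unitVec 0) (chainWindow (-1) 0)).trans
        (PolySite.incl affShiftSet_chainWindow_zero_subset_one)) ρ₃ =
      spinPartialTrace (PolySite.incl chainWindow_zero_subset_one) ρ₃ →
    (∀ k k' : TensorIndex (PolySite (chainWindow (-1) 1)) 4,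
      (∑ x, (siteOcc (k x)).card) ≠ (∑ x, (siteOcc (k' x)).card) → ρ₃ k k' = 0) →
    ((toSpin (nAt (-unitVec 0) neg_unitVec_mem_chainWindow_one 0 + nAt (-unitVec 0) neg_unitVec_mem_chainWindow_one 1) *
        ρ₃).trace).re = ((ν : ℚ) : ℝ) →
    (∀ k k' : TensorIndex (PolySite (chainWindow (-1) 1)) 4, starRingEnd ℂ (ρ₃ k k') = ρ₃ k k') →
    (∀ k k' : TensorIndex (PolySite (chainWindow (-1) 1)) 4, ‖ρ₃ k k'‖ ≤ 1) →
    traceLeft (ω 4) = (cgMap (castTensor A) 2 ⊗ₖ (1 : Matrix (Fin 4) (Fin 4) ℂ)) *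
        (ρ₃.submatrix (Equiv.arrowCongr chainWindowThreeEquiv (Equiv.refl (Fin 4)))
            (Equiv.arrowCongr chainWindowThreeEquiv (Equiv.refl (Fin 4)))).submatrix
          ((Equiv.prodComm _ _).trans (Fin.snocEquiv fun _ => Fin 4))
          ((Equiv.prodComm _ _).trans (Fin.snocEquiv fun _ => Fin 4)) *
      (cgMap (castTensor A) 2 ⊗ₖ (1 : Matrix (Fin 4) (Fin 4) ℂ))ᴴ →
    traceRight ((ω 4).submatrix (Equiv.prodAssoc _ _ _) (Equiv.prodAssoc _ _ _)) =
      ((1 : Matrix (Fin 4) (Fin 4) ℂ) ⊗ₖ cgMap (castTensor A) 2) *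
        (ρ₃.submatrix (Equiv.arrowCongr chainWindowThreeEquiv (Equiv.refl (Fin 4)))
            (Equiv.arrowCongr chainWindowThreeEquiv (Equiv.refl (Fin 4)))).submatrix
          (Fin.consEquiv fun _ => Fin 4) (Fin.consEquiv fun _ => Fin 4) *
      ((1 : Matrix (Fin 4) (Fin 4) ℂ) ⊗ₖ cgMap (castTensor A) 2)ᴴ →
    (∀ k, k + 5 ≤ n + 3 → traceLeft (ω (k + 5)) =
      (leftMap (castTensor A) ⊗ₖ (1 : Matrix (Fin 4) (Fin 4) ℂ)) *
        (ω (k + 4)).submatrix (Equiv.prodAssoc _ _ _) (Equiv.prodAssoc _ _ _) *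
      (leftMap (castTensor A) ⊗ₖ (1 : Matrix (Fin 4) (Fin 4) ℂ))ᴴ) →
    (∀ k, k + 5 ≤ n + 3 → traceRight ((ω (k + 5)).submatrix (Equiv.prodAssoc _ _ _) (Equiv.prodAssoc _ _ _)) =
      ((1 : Matrix (Fin 4) (Fin 4) ℂ) ⊗ₖ rightMap (castTensor A)) * ω (k + 4) *
      ((1 : Matrix (Fin 4) (Fin 4) ℂ) ⊗ₖ rightMap (castTensor A))ᴴ) →
    (∀ k, k + 4 ≤ n + 3 → (ω (k + 4)).PosSemidef) →
    (∀ k, k + 4 ≤ n + 3 → ∀ i j, cgTag (hubbardSrotQeff cb ca) qb i ≠ cgTag (hubbardSrotQeff cb ca) qb j → ω (k + 4) i j = 0) →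
    (∀ k, k + 4 ≤ n + 3 → ∀ i j, starRingEnd ℂ (ω (k + 4) i j) = ω (k + 4) i j) →
    (∀ k, k + 4 ≤ n + 3 → ∀ i j, ‖ω (k + 4) i j‖ ≤ ((B (k + 4) : ℚ) : ℝ)) →
    ((lo : ℚ) : ℝ) ≤ ((toSpin ((U : ℂ) • (nAt (-unitVec 0) neg_unitVec_mem_chainWindow_one 0 *
          nAt (-unitVec 0) neg_unitVec_mem_chainWindow_one 1) +
        (-((1 : ℝ) : ℂ)) • ∑ σ : Fin 2,
          ((cAt (-unitVec 0) neg_unitVec_mem_chainWindow_one σ)ᴴ * cAt 0 zero_mem_chainWindow_one σ.rev +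
            (cAt 0 zero_mem_chainWindow_one σ.rev)ᴴ * cAt (-unitVec 0) neg_unitVec_mem_chainWindow_one σ)) * ρ₃).trace).re

end Nodes

/-! ## §C  Solver-free edges: monotonicity, `jw-srot` window ⇒ standard window, `mps` ⇒ window -/

section Edges

variable {U : ℝ} {n D : ℕ} {A : Fin 4 → Matrix (Fin D) (Fin D) ℚ} {qb : Fin D → ℤ} {cb ca : ℤ} {B : ℕ → ℚ} {ν lo lo' : ℚ}

/-- A node survives a SMALLER slot `lo' ≤ lo`. -/
theorem LTIChainKSDNNodeSrot.mono (h : LTIChainKSDNNodeSrot U n ν lo) (hlo : lo' ≤ lo) : LTIChainKSDNNodeSrot U n ν lo' :=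
  fun ρ h1 h2 h3 h4 h5 h6 h7 => le_trans (by exact_mod_cast hlo) (h ρ h1 h2 h3 h4 h5 h6 h7)

/-- A node survives a SMALLER slot `lo' ≤ lo`. -/
theorem MPSChainKSDNNodeSrot.mono (h : MPSChainKSDNNodeSrot U n D A qb cb ca B ν lo) (hlo : lo' ≤ lo) :
    MPSChainKSDNNodeSrot U n D A qb cb ca B ν lo' :=
  fun ρ₃ ω h1 h2 h3 h4 h5 h6 h7 h8 h9 h10 h11 h12 h13 h14 h15 =>
    le_trans (by exact_mod_cast hlo) (h ρ₃ ω h1 h2 h3 h4 h5 h6 h7 h8 h9 h10 h11 h12 h13 h14 h15)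

/-- **THE `jw-srot` EDGE BY NAME (window level): a `jw-srot` `lti(N)` certificate of the Hubbard chain is a standard `lti(N)`
certificate**, `LTIChainKSDNNodeSrot U n ν lo → LTIChainKSDNNode U n ν lo`. Solver-free: spin-flip midpoint and conjugation by the
staggered product `⨂_x v_x` (`Transport.ksdnClaim_of_srotClaim`). [cite: KullEtAl2024, §II.B, §VI.B] [cite: EsslerEtAl2005, §12.3.4] -/
theorem LTIChainKSDNNodeSrot.ltiChainKSDNNode (h : LTIChainKSDNNodeSrot U n ν lo) : LTIChainKSDNNode U n ν lo :=
  ksdnClaim_of_srotClaim 1 U n h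

/-- Charge covariance of the cast tensor for `q_eff = cb·n_tot − ca` from the RATIONAL check on the table `A`. -/
theorem mpsCovSrot_of_rat (hAcov : ∀ s a b, A s a b ≠ 0 → qb b = qb a + hubbardSrotQeff cb ca s) :
    ∀ s a b, castTensor A s a b ≠ 0 → qb b = qb a + (fun s : Fin 4 => cb * ((siteOcc s).card : ℤ) - ca) s :=
  fun s a b h => hAcov s a b ((castTensor_apply_ne_zero_iff A s a b).1 h)

/-- **THE `mps` EDGE BY NAME: a `jw-srot` `mps(N, D, A)` certificate is a `jw-srot` `lti(N)` certificate** (`N = n + 3 ≥ 4`): under the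
rational side conditions (charge covariance of `A` for `hubbardSrotQeff cb ca`; `frobSqQ (transferOpQ A ^ (m−2)) ≤ (B m)²`, `0 ≤ B m`),
`MPSChainKSDNNodeSrot U n D A qb cb ca B ν lo → LTIChainKSDNNodeSrot U n ν lo`. Solver-free: KSDN's feasible point
(`Transport.ksdnSrotClaim_of_mpsSrotClaim`). [cite: KullEtAl2024, §4.2] -/
theorem MPSChainKSDNNodeSrot.ltiChainKSDNNodeSrot (h : MPSChainKSDNNodeSrot U n D A qb cb ca B ν lo) (hn : 1 ≤ n)
    (hAcov : ∀ s a b, A s a b ≠ 0 → qb b = qb a + hubbardSrotQeff cb ca s)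
    (hB : ∀ k, k + 4 ≤ n + 3 → 0 ≤ B (k + 4) ∧ frobSqQ (transferOpQ A ^ (k + 2)) ≤ B (k + 4) ^ 2) :
    LTIChainKSDNNodeSrot U n ν lo :=
  ksdnSrotClaim_of_mpsSrotClaim 1 U n hn (castTensor A) (star_castTensor_apply A) qb cb ca (mpsCovSrot_of_rat hAcov)
    (fun m => ((B m : ℚ) : ℝ)) (mpsBounds_of_rat hB) chainWindowThreeEquiv chainWindowThreeEquiv_coord h

/-- **`jw-srot` `mps(N, D, A)` certificate ⇒ standard `lti(N)` certificate** (the composite edge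
`MPSChainKSDNNodeSrot → LTIChainKSDNNodeSrot → LTIChainKSDNNode`). [cite: KullEtAl2024, §4.2, §VI.B] -/
theorem MPSChainKSDNNodeSrot.ltiChainKSDNNode (h : MPSChainKSDNNodeSrot U n D A qb cb ca B ν lo) (hn : 1 ≤ n)
    (hAcov : ∀ s a b, A s a b ≠ 0 → qb b = qb a + hubbardSrotQeff cb ca s)
    (hB : ∀ k, k + 4 ≤ n + 3 → 0 ≤ B (k + 4) ∧ frobSqQ (transferOpQ A ^ (k + 2)) ≤ B (k + 4) ^ 2) :
    LTIChainKSDNNode U n ν lo :=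
  (h.ltiChainKSDNNodeSrot hn hAcov hB).ltiChainKSDNNode

end Edges

/-! ## §D  The M1 cells BY NAME (through `LTIChainKSDNNode`'s cells) -/

section Cells

variable {U : ℝ} {n D : ℕ} {A : Fin 4 → Matrix (Fin D) (Fin D) ℚ} {qb : Fin D → ℤ} {cb ca : ℤ} {B : ℕ → ℚ} {ν lo : ℚ} {p q : ℕ}

/-- `jw-srot` window node at total first-site density `1` ⇒ the M1 energy LOWER row `lo ≤ e₀(U)` (`U ≥ 0`). -/
theorem LTIChainKSDNNodeSrot.m1EnergyLowerRow (h : LTIChainKSDNNodeSrot U n 1 lo) (hU : 0 ≤ U) : M1EnergyLowerRow U lo :=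
  h.ltiChainKSDNNode.m1EnergyLowerRow hU

/-- `jw-srot` window node at total first-site density `ν = p/q` ⇒ the M1 doped energy LOWER row at filling `p/q`. -/
theorem LTIChainKSDNNodeSrot.m1DopedEnergyLowerRow (h : LTIChainKSDNNodeSrot U n ν lo) (hU : 0 ≤ U) (hq : 1 ≤ q)
    (hp : p ≤ 2 * q) (hν : ((ν : ℚ) : ℝ) = (p : ℝ) / (q : ℝ)) : M1DopedEnergyLowerRow U p q lo :=
  h.ltiChainKSDNNode.m1DopedEnergyLowerRow hU hq hp hν

/-- **M1 cell BY NAME** (`ν = 1`, `U ≥ 0`): a `jw-srot` `mps` node at half filling ⇒ `lo ≤ e₀(U)` (`M1EnergyLowerRow U lo`). -/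
theorem MPSChainKSDNNodeSrot.m1EnergyLowerRow (h : MPSChainKSDNNodeSrot U n D A qb cb ca B 1 lo) (hn : 1 ≤ n) (hU : 0 ≤ U)
    (hAcov : ∀ s a b, A s a b ≠ 0 → qb b = qb a + hubbardSrotQeff cb ca s)
    (hB : ∀ k, k + 4 ≤ n + 3 → 0 ≤ B (k + 4) ∧ frobSqQ (transferOpQ A ^ (k + 2)) ≤ B (k + 4) ^ 2) :
    M1EnergyLowerRow U lo :=
  (h.ltiChainKSDNNode hn hAcov hB).m1EnergyLowerRow hU

/-- **M1 doped cell BY NAME** (total density of the first site `ν = p/q`, `1 ≤ q`, `p ≤ 2q`, `U ≥ 0`): `lo ≤ e₀(U, n = p/q)`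
(`M1DopedEnergyLowerRow U p q lo`). -/
theorem MPSChainKSDNNodeSrot.m1DopedEnergyLowerRow (h : MPSChainKSDNNodeSrot U n D A qb cb ca B ν lo) (hn : 1 ≤ n) (hU : 0 ≤ U)
    (hq : 1 ≤ q) (hp : p ≤ 2 * q) (hν : ((ν : ℚ) : ℝ) = (p : ℝ) / (q : ℝ))
    (hAcov : ∀ s a b, A s a b ≠ 0 → qb b = qb a + hubbardSrotQeff cb ca s)
    (hB : ∀ k, k + 4 ≤ n + 3 → 0 ≤ B (k + 4) ∧ frobSqQ (transferOpQ A ^ (k + 2)) ≤ B (k + 4) ^ 2) :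
    M1DopedEnergyLowerRow U p q lo :=
  (h.ltiChainKSDNNode hn hAcov hB).m1DopedEnergyLowerRow hU hq hp hν

end Cells

end Summit.Ventures.CertifiedManyBodySolver
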